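import Summits.QuantumFields.YangMills.Theorems.UnitScaleTiltProp7ChartRemainderAbstractTrisection
import Summits.QuantumFields.YangMills.Theorems.UnitScaleTiltProp7GaugePieceSupRow
import Summits.QuantumFields.YangMills.Theorems.UnitScaleTiltProp7BCHPiecePackaged
import Summits.QuantumFields.YangMills.Theorems.UnitScaleTiltProp7ConjCoeffRows
import HarnessLib

/-!
# Prop 7, route-R E′, (E1-c) F4i — THE CHART REMAINDER, BOND (`ℓ·sup`) MEMBER: `‖N(ψ)(b) − N(ψ′)(b)‖ ≤ (P₁ bond row) + (P₂ bond row) + (P₃ bond row)`, ONE THEOREM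

Route `UnitScaleTilt`, crux K1 child «MinimiserStabilityRegPr» (`stmt-QuantumFields-19200`), cell ym3-torus, width seat px15 (gen 2); pen «px15 g2: (E1-c) GO-LOCATE» (★p1 g15,
2026-08-28T20:45:05Z), LOCATE `LOCATE-E1C-DIVLIPSCHITZ-px15g2.md` §6.  THEOREMS ONLY (0 `def`, 0 `sorry`); `--supports stmt-QuantumFields-19200`, count-neutral.
YM₃ on T³ is a ladder rung (R3), not the Clay problem; nothing here claims the stub, the crux, d = 4 or the mass gap.

WHAT.  The second member `ℓ·sup_b‖A b‖` of ✓p667460's `q`-gauge for `A = N(ψ) − N(ψ′)`: with the letters of F4h ⧗p675364 (`u = e^{c•ψ}` unitary, data `E`, `B = log E`, `‖B‖ ≤ β ≤ 1∕40`),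
  ★★★ `norm_chartRemainder_bond_sub_le`: `‖N(ψ)(μ,y) − N(ψ′)(μ,y)‖ ≤ 2β‖u y − u′ y‖ + [2m·δ_d + 2e^{2R₀}m_d·δ′ + ((A+2A²)Kδ_d + (4A∕3+6A²)K²m_d)] + β(24Kᵘ·mᵘ_d + 8δᵘ_d)`
(P₁: F4d(i) ✓p673871 `norm_conjCoeff_sub_le`; P₂: F4c(v) ✓p673544 `norm_gaugePiece_bond_sub_le` with scalar `−c`; P₃: F4g ✓p675104 `norm_bchPiece_bond_sub_le`; glued by F4f ✓p674854).
Multiplying by `ℓ`: every summand is (row) × (row of `ψ − ψ′`).  HONEST SCOPE.  Assembly ([folklore]).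

References: T. Bałaban, CMP 98 (1985) 17–51 [Balaban1985Averaging] ((19)–(21) p.21, (26), (32)–(34) p.22).
-/

set_option autoImplicit false

noncomputable section

open scoped BigOperators Matrix.Norms.L2Operator Matrix
open NormedSpace

namespace Summit.QuantumFields.YangMills.Theorems.Prop7ChartRemainderSupRow

open Literature.MathematicalPhysics.QuantumFieldTheory.Balaban1983to89
open MatrixLog (mlog)
open B9Eq39Adjoint (R covD)
open Literature.Analysis.Complex (logOnePlus)
open Summit.QuantumFields.YangMills.Theorems.Prop7ChartRemainderAbstractTrisection (chartRemainder_eq_three_pieces expField_unitary)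
open Summit.QuantumFields.YangMills.Theorems.Prop7GaugePieceSupRow (norm_gaugePiece_bond_sub_le)
open Summit.QuantumFields.YangMills.Theorems.Prop7BCHPiecePackaged (norm_bchPiece_bond_sub_le norm_gaugeLog_le)
open Summit.QuantumFields.YangMills.Theorems.Prop7ConjCoeffRows (norm_conjCoeff_sub_le)

variable {n : Type*} [Fintype n] [DecidableEq n] [Nonempty n]
variable {S : Type*} {ι : Type*} (T : ι → Equiv.Perm S) (U : ι → S → (Matrix n n ℂ)ˣ)

/-- ★★★ **THE CHART REMAINDER, BOND ROW** (see the module docstring). [cite: Balaban1985Averaging, (19)-(21) p.21, (32)-(34) p.22] -/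
theorem norm_chartRemainder_bond_sub_le
    (hstarR : ∀ μ y (M : Matrix n n ℂ), star (R (U μ y) M) = R (U μ y) (star M))
    {c : ℂ} (hc : ‖c‖ ≤ 1) (ψ ψ' : S → Matrix n n ℂ)
    (hskew : ∀ y, star (c • ψ y) = -(c • ψ y)) (hskew' : ∀ y, star (c • ψ' y) = -(c • ψ' y))
    (hu1 : ∀ y, ‖exp (c • ψ y)‖ ≤ 1) (hu1' : ∀ y, ‖exp (c • ψ' y)‖ ≤ 1)
    (En : ι → S → Matrix n n ℂ) (hE : ∀ μ y, ‖En μ y - 1‖ < 1) {β : ℝ} (hβ : ∀ μ y, ‖mlog (En μ y)‖ ≤ β) (hβ40 : β ≤ 1 / 40)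
    {R₀ m md δ δ' δd : ℝ}
    (hm : ∀ y, ‖ψ y‖ ≤ m) (hmR : m ≤ R₀) (hmhalf : m ≤ 1 / 2) (hm' : ∀ y, ‖ψ' y‖ ≤ R₀) (hmd : ∀ y, ‖ψ y - ψ' y‖ ≤ md)
    (hδ0 : 0 ≤ δ) (hδ : ∀ μ y, ‖covD T U μ ψ y‖ ≤ δ) (hδ'0 : 0 ≤ δ') (hδ' : ∀ μ y, ‖covD T U μ ψ' y‖ ≤ δ')
    (hδd : ∀ μ y, ‖covD T U μ ψ y - covD T U μ ψ' y‖ ≤ δd)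
    (hs : Real.exp R₀ * Real.exp (R₀ + (δ + δ')) * (δ + δ') ≤ 1 / 2)
    {mud K δud : ℝ} (hmud : ∀ y, ‖exp (c • ψ y) - exp (c • ψ' y)‖ ≤ mud)
    (hDu : ∀ μ y, ‖covD T U μ (fun z => exp (c • ψ z)) y‖ ≤ K) (hDu' : ∀ μ y, ‖covD T U μ (fun z => exp (c • ψ' z)) y‖ ≤ K) (hK : K ≤ 1 / 80)
    (hδud : ∀ μ y, ‖covD T U μ (fun z => exp (c • ψ z)) y - covD T U μ (fun z => exp (c • ψ' z)) y‖ ≤ δud) (μ : ι) (y : S) :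
    ‖(mlog (exp (c • ψ y) * En μ y * star (R (U μ y) (exp (c • ψ (T μ y))))) - mlog (En μ y) + c • covD T U μ ψ y)
        - (mlog (exp (c • ψ' y) * En μ y * star (R (U μ y) (exp (c • ψ' (T μ y))))) - mlog (En μ y) + c • covD T U μ ψ' y)‖
      ≤ 2 * ‖exp (c • ψ y) - exp (c • ψ' y)‖ * β
        + (2 * m * δd + 2 * Real.exp (2 * R₀) * md * δ'
            + (((Real.exp R₀ * Real.exp (R₀ + (δ + δ'))) + 2 * (Real.exp R₀ * Real.exp (R₀ + (δ + δ'))) ^ 2) * (δ + δ') * δd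
              + (4 / 3 * (Real.exp R₀ * Real.exp (R₀ + (δ + δ'))) + 6 * (Real.exp R₀ * Real.exp (R₀ + (δ + δ'))) ^ 2) * (δ + δ') ^ 2 * md))
        + β * (24 * K * mud + 8 * δud) := by
  have huu : ∀ y, exp (c • ψ y) * star (exp (c • ψ y)) = 1 := fun y => (expField_unitary (hskew y)).1
  have huu' : ∀ y, exp (c • ψ' y) * star (exp (c • ψ' y)) = 1 := fun y => (expField_unitary (hskew' y)).1
  have hK2 : K ≤ 1 / 2 := hK.trans (by norm_num)
  have hQ : ‖exp (c • ψ y) * star (R (U μ y) (exp (c • ψ (T μ y)))) - 1‖ < 1 :=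
    ((norm_gaugeLog_le T U μ (u := fun z => exp (c • ψ z)) hu1 huu y (hDu μ y) hK2).1).trans_lt (by linarith)
  have hQ' : ‖exp (c • ψ' y) * star (R (U μ y) (exp (c • ψ' (T μ y)))) - 1‖ < 1 :=
    ((norm_gaugeLog_le T U μ (u := fun z => exp (c • ψ' z)) hu1' huu' y (hDu' μ y) hK2).1).trans_lt (by linarith)
  rw [chartRemainder_eq_three_pieces T U hstarR ψ hskew En μ y (hE μ y) hQ,
    chartRemainder_eq_three_pieces T U hstarR ψ' hskew' En μ y (hE μ y) hQ']
  -- P₁ bond row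
  have hP1 : ‖(exp (c • ψ y) * mlog (En μ y) * star (exp (c • ψ y)) - mlog (En μ y))
        - (exp (c • ψ' y) * mlog (En μ y) * star (exp (c • ψ' y)) - mlog (En μ y))‖ ≤ 2 * ‖exp (c • ψ y) - exp (c • ψ' y)‖ * β :=
    (norm_conjCoeff_sub_le (hu1 y) (hu1' y) _).trans (mul_le_mul_of_nonneg_left (hβ μ y) (by positivity))
  -- P₂ bond row (scalar −c)
  have hnc : ‖-c‖ ≤ 1 := by rwa [norm_neg]
  have hP2 := norm_gaugePiece_bond_sub_le T U hnc ψ ψ' hm hmR hmhalf hm' hmd hδ0 hδ hδ'0 hδ' hδd hs μ y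
  -- P₃ bond row
  have hP3 := norm_bchPiece_bond_sub_le T U (u := fun z => exp (c • ψ z)) (u' := fun z => exp (c • ψ' z)) hu1 hu1' huu huu'
    (fun μ y => mlog (En μ y)) hβ hβ40 hDu hDu' hK hmud hδud μ y
  beta_reduce at hP3
  calc _ ≤ ‖(exp (c • ψ y) * mlog (En μ y) * star (exp (c • ψ y)) - mlog (En μ y))
          - (exp (c • ψ' y) * mlog (En μ y) * star (exp (c • ψ' y)) - mlog (En μ y))‖
        + (‖(logOnePlus (exp (-((-c) • ψ y)) * (exp ((-c) • ψ y + (-c) • covD T U μ ψ y) - exp ((-c) • ψ y))) - (-c) • covD T U μ ψ y)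
            - (logOnePlus (exp (-((-c) • ψ' y)) * (exp ((-c) • ψ' y + (-c) • covD T U μ ψ' y) - exp ((-c) • ψ' y))) - (-c) • covD T U μ ψ' y)‖
          + ‖(mlog (exp (exp (c • ψ y) * mlog (En μ y) * star (exp (c • ψ y))) * exp (mlog (exp (c • ψ y) * star (R (U μ y) (exp (c • ψ (T μ y)))))))
                - exp (c • ψ y) * mlog (En μ y) * star (exp (c • ψ y)) - mlog (exp (c • ψ y) * star (R (U μ y) (exp (c • ψ (T μ y))))))
            - (mlog (exp (exp (c • ψ' y) * mlog (En μ y) * star (exp (c • ψ' y))) * exp (mlog (exp (c • ψ' y) * star (R (U μ y) (exp (c • ψ' (T μ y)))))))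
                - exp (c • ψ' y) * mlog (En μ y) * star (exp (c • ψ' y)) - mlog (exp (c • ψ' y) * star (R (U μ y) (exp (c • ψ' (T μ y))))))‖) := by
        have e : ∀ (a₁ a₂ b₁ b₂ c₁ c₂ : Matrix n n ℂ), (a₁ + b₁ + c₁) - (a₂ + b₂ + c₂) = (a₁ - a₂) + ((b₁ - b₂) + (c₁ - c₂)) := fun _ _ _ _ _ _ => by abel
        rw [e]
        exact (norm_add_le _ _).trans (add_le_add le_rfl (norm_add_le _ _))
    _ ≤ _ := by linarith [hP1, hP2, hP3]

end Summit.QuantumFields.YangMills.Theorems.Prop7ChartRemainderSupRow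

end
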